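import Literature.MathematicalPhysics.QuantumFieldTheory.Balaban1983to89.Setup
import HarnessLib

/-!
# Crux `HistoryTailL` (stmt-QuantumFields-19936), line #13 `local_insertion` — THE COMB GAUGE OF A BOX AND ITS LADDERS
# (non-abelian Stokes by `dist1`): every gauged link of the complete axial gauge is within `Σ_{ladder plaquettes} dist1 U(∂p)` of `1`

Cell `ym3-torus` (YM ladder rung R3 = continuum SU(2) Yang–Mills on the three-torus — a RUNG, NOT the Clay problem: not d = 4, not
infinite volume, not a mass gap), width seat `ym-ust-19936-w3` gen 11, `--supports stmt-QuantumFields-19936 --as helper`.  THEOREMS ONLY,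
definition-free (the holonomies and the gauge are hypothesis-functions / existential witnesses), ROUTE-INDEPENDENT (`Setup` only).
HONEST FRAMING: deterministic group algebra on the lattice `T^{(j)}` of `Setup` for an arbitrary `GaugeGroup`; nothing probabilistic, nothing of
`LocalInsertionL` (23607), the stubs of `Cruxes/HistoryTailL/Lines/local_insertion.lean`, the crux `HistoryTailL` or any summit statement is proved.

WHY (located on the cell bus, «MEDIAN-1 ⇐ EQUIPARTITION»).  With ✓`stub_levelOneLipschitz` at `U′ = 1` and gauge invariance, the height-one block
flux is bounded ON THE WINDOW by `(CL/√L)·d_box(U^g, 1)` for every gauge copy `U^g`; in the comb gauge below `d_box(U^g,1)` is controlled by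
plaquette variables of `U` LINEARLY, so the height-one median row of engine (E3) reduces to the first moment of `dist1 U(∂p)` at scale `g_K` under
the Gibbs law (the equipartition-type bound) — see the companion `LocalInsertionMedianHeightOneOfEquipartition`.
* §1 ★`dist1_ladder_le` — the LADDER LEMMA in any `GaugeGroup`: rails `V′ (t+1) = V′ t·a t`, `V (t+1) = V t·c t`, rungs `u t`;
  `dist1 (V′ k·u k·(V k)⁻¹·(u 0)⁻¹) ≤ Σ_{t<k} dist1 (a t·u (t+1)·(c t)⁻¹·(u t)⁻¹)` (`W_{k+1} = (V′_k Q_k V′_k⁻¹)·W_k`, `dist1` conjugation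
  invariant and subadditive).
* §2 site bookkeeping on `Site P j = Fin d → ZMod N` (`shift_eq_update`, `shift_update_self`, `shift_update_of_ne`, `update_add_natCast_zero`,
  `eq_base_add_offset`, `offset_shift_self` (no wrap-around), `offset_shift_of_ne`); ★`dist1_ladderLoop_le` — the ladder loop in the
  `(μ, ν)`-plane (`μ < ν`) based at `p`: `dist1 (H p ν k · U⟨p + k e_ν, μ⟩ · (H (p+e_μ) ν k)⁻¹ · U⟨p, μ⟩⁻¹) ≤ Σ_{t<k} dist1 U(∂⟨p + t e_ν, μ, ν⟩)`
  for ANY straight-segment holonomy function `H` (`H y μ 0 = 1`, `H y μ (t+1) = H y μ t · U⟨y + t e_μ, μ⟩`); the three directions of the comb: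
  `gaugeAct_comb_top` (`U^g = 1` on top-direction bonds), `dist1_gaugeAct_comb_mid` (one ladder), `dist1_gaugeAct_comb_bot` (two ladders).
* the box theorem ★★`exists_combGauge_dist1_le` (all three directions at once, a configuration-independent plaquette family) is in the
  companion `LocalInsertionCombGaugeBox` (400-line cap).
[folklore]
-/

set_option autoImplicit false

open Literature.MathematicalPhysics.QuantumFieldTheory.Balaban1983to89

namespace Summit.QuantumFields.YangMills.Theorems.LocalInsertion.CombGauge


/-! ## §1 The ladder lemma -/

section Ladder
variable {G : Type*} [GaugeGroup G]

/-- **THE LADDER LEMMA** (non-abelian Stokes for a ladder, by `dist1`'s conjugation invariance and subadditivity): rails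
`V' (t+1) = V' t · a t`, `V (t+1) = V t · c t` from `V' 0 = V 0 = 1`, rungs `u t`; the loop `V' k · u k · (V k)⁻¹ · (u 0)⁻¹` has
`dist1 ≤ Σ_{t<k} dist1 (a t · u (t+1) · (c t)⁻¹ · (u t)⁻¹)` (one plaquette per rung). [folklore] -/
theorem dist1_ladder_le (a c u V' V : ℕ → G) (hV'0 : V' 0 = 1) (hV0 : V 0 = 1)
    (hV' : ∀ t, V' (t + 1) = V' t * a t) (hV : ∀ t, V (t + 1) = V t * c t) (k : ℕ) :
    dist1 (V' k * u k * (V k)⁻¹ * (u 0)⁻¹) ≤ ∑ t ∈ Finset.range k, dist1 (a t * u (t + 1) * (c t)⁻¹ * (u t)⁻¹) := by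
  induction k with
  | zero => simp [hV'0, hV0, GaugeGroup.dist1_one]
  | succ k ih =>
    rw [Finset.sum_range_succ]
    have hstep : V' (k + 1) * u (k + 1) * (V (k + 1))⁻¹ * (u 0)⁻¹ =
        (V' k * (a k * u (k + 1) * (c k)⁻¹ * (u k)⁻¹) * (V' k)⁻¹) * (V' k * u k * (V k)⁻¹ * (u 0)⁻¹) := by
      rw [hV' k, hV k, mul_inv_rev]
      group
    rw [hstep]
    calc dist1 ((V' k * (a k * u (k + 1) * (c k)⁻¹ * (u k)⁻¹) * (V' k)⁻¹) * (V' k * u k * (V k)⁻¹ * (u 0)⁻¹))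
        ≤ dist1 (V' k * (a k * u (k + 1) * (c k)⁻¹ * (u k)⁻¹) * (V' k)⁻¹) + dist1 (V' k * u k * (V k)⁻¹ * (u 0)⁻¹) :=
          GaugeGroup.dist1_mul_le _ _
      _ = dist1 (a k * u (k + 1) * (c k)⁻¹ * (u k)⁻¹) + dist1 (V' k * u k * (V k)⁻¹ * (u 0)⁻¹) := by
          rw [GaugeGroup.dist1_conj]
      _ ≤ _ := by linarith

end Ladder

/-! ## §2 Site bookkeeping, the ladder loop, the three comb directions -/

section Comb

variable {P : Params} {j : ℕ} {G : Type*} [GaugeGroup G]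

/-- `shift` is `update` by `+1`. [folklore] -/
theorem shift_eq_update (x : Site P j) (μ : Fin P.d) : x.shift μ = Function.update x μ (x μ + 1) := rfl

/-- Stepping once more along a straight segment. [folklore] -/
theorem shift_update_self (x : Site P j) (μ : Fin P.d) (s : ℕ) :
    Site.shift (Function.update x μ (x μ + (s : ZMod (P.sitesPerDir j))) : Site P j) μ =
      Function.update x μ (x μ + ((s + 1 : ℕ) : ZMod (P.sitesPerDir j))) := by
  rw [shift_eq_update, Function.update_idem, Function.update_self]
  congr 1
  push_cast
  ring

/-- Shifting in another direction commutes with the straight-segment update. [folklore] -/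
theorem shift_update_of_ne (x : Site P j) {μ ν : Fin P.d} (h : μ ≠ ν) (v : ZMod (P.sitesPerDir j)) :
    Site.shift (Function.update x μ v : Site P j) ν = Function.update (x.shift ν) μ v := by
  rw [shift_eq_update, shift_eq_update, Function.update_of_ne (Ne.symm h), Function.update_comm (Ne.symm h)]

/-- The zero-length segment ends where it starts. [folklore] -/
theorem update_add_natCast_zero (x : Site P j) (μ : Fin P.d) :
    Function.update x μ (x μ + ((0 : ℕ) : ZMod (P.sitesPerDir j))) = x := by
  rw [Nat.cast_zero, add_zero, Function.update_eq_self]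

/-- **COMB GAUGE, TOP DIRECTION**: with straight-segment holonomies `H y μ t` (`H y μ 0 = 1`, `H y μ (t+1) = H y μ t · U⟨y + t e_μ, μ⟩`) and a
gauge transformation that on the point `x = p₂ + k e₂` (`p₂ = p₁ + j e₁`, `p₁ = base + i e₀`) equals `A · H p₂ μ₂ k` with `A` independent of
`k`, the gauged bond variable of the `μ₂`-bond at `x` is `1`. [folklore] -/
theorem gaugeAct_comb_top (U : GaugeField P j G) (H : Site P j → Fin P.d → ℕ → G)
    (hHs : ∀ y μ t, H y μ (t + 1) = H y μ t * U ⟨Function.update y μ (y μ + (t : ZMod (P.sitesPerDir j))), μ⟩)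
    (g : GaugeTransf P j G) (p₂ : Site P j) (μ₂ : Fin P.d) (A : G) (k : ℕ)
    (hgk : g (Function.update p₂ μ₂ (p₂ μ₂ + (k : ZMod (P.sitesPerDir j)))) = A * H p₂ μ₂ k)
    (hgk1 : g (Function.update p₂ μ₂ (p₂ μ₂ + ((k + 1 : ℕ) : ZMod (P.sitesPerDir j)))) = A * H p₂ μ₂ (k + 1)) :
    GaugeField.gaugeAct g U ⟨Function.update p₂ μ₂ (p₂ μ₂ + (k : ZMod (P.sitesPerDir j))), μ₂⟩ = 1 := by
  unfold GaugeField.gaugeAct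
  simp only [PBond.tgt]
  rw [shift_update_self, hgk, hgk1, hHs]
  group

/-- **THE LADDER LOOP** in the `(μ, ν)`-plane, `μ < ν`, based at `p`, height `k`: rails `H p ν k` and `H (p + e_μ) ν k`, rungs the
`μ`-bonds; `dist1(rail · top rung · rail'⁻¹ · bottom rung⁻¹) ≤ Σ_{t<k} dist1 U(∂⟨p + t e_ν, μ, ν⟩)` (each rung step is the inverse
plaquette variable). [folklore] -/
theorem dist1_ladderLoop_le (U : GaugeField P j G) (H : Site P j → Fin P.d → ℕ → G)
    (hH0 : ∀ y μ, H y μ 0 = 1)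
    (hHs : ∀ y μ t, H y μ (t + 1) = H y μ t * U ⟨Function.update y μ (y μ + (t : ZMod (P.sitesPerDir j))), μ⟩)
    (p : Site P j) {μ ν : Fin P.d} (hμν : μ < ν) (k : ℕ) :
    dist1 (H p ν k * U ⟨Function.update p ν (p ν + (k : ZMod (P.sitesPerDir j))), μ⟩ * (H (p.shift μ) ν k)⁻¹ * (U ⟨p, μ⟩)⁻¹) ≤
      ∑ t ∈ Finset.range k, dist1 (GaugeField.plaqHol U
        ⟨Function.update p ν (p ν + (t : ZMod (P.sitesPerDir j))), μ, ν, hμν⟩) := by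
  have hne' : ν ≠ μ := (ne_of_lt hμν).symm
  set a : ℕ → G := fun t => U ⟨Function.update p ν (p ν + (t : ZMod (P.sitesPerDir j))), ν⟩ with ha
  set c : ℕ → G := fun t => U ⟨Function.update (p.shift μ) ν ((p.shift μ) ν + (t : ZMod (P.sitesPerDir j))), ν⟩ with hc
  set u : ℕ → G := fun t => U ⟨Function.update p ν (p ν + (t : ZMod (P.sitesPerDir j))), μ⟩ with hu
  have hlad := dist1_ladder_le a c u (fun t => H p ν t) (fun t => H (p.shift μ) ν t) (hH0 _ _) (hH0 _ _)
    (fun t => hHs p ν t) (fun t => hHs (p.shift μ) ν t) k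
  have hu0 : u 0 = U ⟨p, μ⟩ := by simp only [hu]; rw [update_add_natCast_zero]
  have huk : u k = U ⟨Function.update p ν (p ν + (k : ZMod (P.sitesPerDir j))), μ⟩ := rfl
  rw [← hu0, ← huk]
  refine hlad.trans (le_of_eq (Finset.sum_congr rfl fun t _ => ?_))
  have hz1 : Function.update p ν (p ν + ((t + 1 : ℕ) : ZMod (P.sitesPerDir j))) =
      Site.shift (Function.update p ν (p ν + (t : ZMod (P.sitesPerDir j))) : Site P j) ν :=
    (shift_update_self p ν t).symm
  have hz2 : Function.update (p.shift μ) ν ((p.shift μ) ν + (t : ZMod (P.sitesPerDir j))) =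
      Site.shift (Function.update p ν (p ν + (t : ZMod (P.sitesPerDir j))) : Site P j) μ := by
    rw [shift_update_of_ne _ hne', shift_eq_update p μ, Function.update_of_ne hne']
  simp only [ha, hc, hu]
  rw [hz1, hz2, ← GaugeGroup.dist1_inv]
  unfold GaugeField.plaqHol
  congr 1
  simp only [mul_inv_rev, inv_inv, mul_assoc]

/-- **COMB GAUGE, MIDDLE DIRECTION** (one ladder, in the `(μ₁, μ₂)`-plane): for the `μ₁`-bond at `x = p₂ + k e₂`, with `g x = A · H p₂ μ₂ k` and
`g (x + e₁) = A · U⟨p₂, μ₁⟩ · H (p₂ + e₁) μ₂ k` (`A` = the comb up to `p₂`), `dist1 (U^g ⟨x, μ₁⟩) ≤ Σ_{t<k} dist1 U(∂⟨p₂ + t e₂, μ₁, μ₂⟩)`. [folklore] -/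
theorem dist1_gaugeAct_comb_mid (U : GaugeField P j G) (H : Site P j → Fin P.d → ℕ → G)
    (hH0 : ∀ y μ, H y μ 0 = 1)
    (hHs : ∀ y μ t, H y μ (t + 1) = H y μ t * U ⟨Function.update y μ (y μ + (t : ZMod (P.sitesPerDir j))), μ⟩)
    (g : GaugeTransf P j G) (p₂ : Site P j) {μ₁ μ₂ : Fin P.d} (h12 : μ₁ < μ₂) (A : G) (k : ℕ)
    (hgk : g (Function.update p₂ μ₂ (p₂ μ₂ + (k : ZMod (P.sitesPerDir j)))) = A * H p₂ μ₂ k)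
    (hgk' : g (Function.update (p₂.shift μ₁) μ₂ ((p₂.shift μ₁) μ₂ + (k : ZMod (P.sitesPerDir j)))) =
      A * U ⟨p₂, μ₁⟩ * H (p₂.shift μ₁) μ₂ k) :
    dist1 (GaugeField.gaugeAct g U ⟨Function.update p₂ μ₂ (p₂ μ₂ + (k : ZMod (P.sitesPerDir j))), μ₁⟩) ≤
      ∑ t ∈ Finset.range k, dist1 (GaugeField.plaqHol U
        ⟨Function.update p₂ μ₂ (p₂ μ₂ + (t : ZMod (P.sitesPerDir j))), μ₁, μ₂, h12⟩) := by
  have hne' : μ₂ ≠ μ₁ := (ne_of_lt h12).symm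
  have htgt : Site.shift (Function.update p₂ μ₂ (p₂ μ₂ + (k : ZMod (P.sitesPerDir j))) : Site P j) μ₁ =
      Function.update (p₂.shift μ₁) μ₂ ((p₂.shift μ₁) μ₂ + (k : ZMod (P.sitesPerDir j))) := by
    rw [shift_update_of_ne _ hne', shift_eq_update p₂ μ₁, Function.update_of_ne hne']
  have hbond : GaugeField.gaugeAct g U ⟨Function.update p₂ μ₂ (p₂ μ₂ + (k : ZMod (P.sitesPerDir j))), μ₁⟩ =
      A * (H p₂ μ₂ k * U ⟨Function.update p₂ μ₂ (p₂ μ₂ + (k : ZMod (P.sitesPerDir j))), μ₁⟩ *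
        (H (p₂.shift μ₁) μ₂ k)⁻¹ * (U ⟨p₂, μ₁⟩)⁻¹) * A⁻¹ := by
    unfold GaugeField.gaugeAct
    simp only [PBond.tgt]
    rw [htgt, hgk, hgk']
    simp only [mul_inv_rev]
    group
  rw [hbond, GaugeGroup.dist1_conj]
  exact dist1_ladderLoop_le U H hH0 hHs p₂ h12 k

/-- **COMB GAUGE, BOTTOM DIRECTION** (two ladders, in the `(μ₀, μ₂)`- and `(μ₀, μ₁)`-planes): for the `μ₀`-bond at `x = p₂ + k e₂`,
`p₂ = p₁ + j e₁`, with `g x = A₀ · H p₁ μ₁ j · H p₂ μ₂ k` and `g (x + e₀) = A₀ · U⟨p₁, μ₀⟩ · H (p₁ + e₀) μ₁ j · H (p₂ + e₀) μ₂ k`,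
`dist1 (U^g ⟨x, μ₀⟩) ≤ Σ_{t<k} dist1 U(∂⟨p₂ + t e₂, μ₀, μ₂⟩) + Σ_{t<j} dist1 U(∂⟨p₁ + t e₁, μ₀, μ₁⟩)`. [folklore] -/
theorem dist1_gaugeAct_comb_bot (U : GaugeField P j G) (H : Site P j → Fin P.d → ℕ → G)
    (hH0 : ∀ y μ, H y μ 0 = 1)
    (hHs : ∀ y μ t, H y μ (t + 1) = H y μ t * U ⟨Function.update y μ (y μ + (t : ZMod (P.sitesPerDir j))), μ⟩)
    (g : GaugeTransf P j G) (p₁ : Site P j) {μ₀ μ₁ μ₂ : Fin P.d} (h01 : μ₀ < μ₁) (h02 : μ₀ < μ₂) (A₀ : G)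
    (i k : ℕ)
    (hgk : g (Function.update (Function.update p₁ μ₁ (p₁ μ₁ + (i : ZMod (P.sitesPerDir j)))) μ₂
        ((Function.update p₁ μ₁ (p₁ μ₁ + (i : ZMod (P.sitesPerDir j)))) μ₂ + (k : ZMod (P.sitesPerDir j)))) =
      A₀ * H p₁ μ₁ i * H (Function.update p₁ μ₁ (p₁ μ₁ + (i : ZMod (P.sitesPerDir j)))) μ₂ k)
    (hgk' : g (Function.update (Site.shift (Function.update p₁ μ₁ (p₁ μ₁ + (i : ZMod (P.sitesPerDir j))) : Site P j) μ₀) μ₂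
        ((Site.shift (Function.update p₁ μ₁ (p₁ μ₁ + (i : ZMod (P.sitesPerDir j))) : Site P j) μ₀) μ₂ + (k : ZMod (P.sitesPerDir j)))) =
      A₀ * U ⟨p₁, μ₀⟩ * H (p₁.shift μ₀) μ₁ i *
        H (Site.shift (Function.update p₁ μ₁ (p₁ μ₁ + (i : ZMod (P.sitesPerDir j))) : Site P j) μ₀) μ₂ k) :
    dist1 (GaugeField.gaugeAct g U ⟨Function.update (Function.update p₁ μ₁ (p₁ μ₁ + (i : ZMod (P.sitesPerDir j)))) μ₂
        ((Function.update p₁ μ₁ (p₁ μ₁ + (i : ZMod (P.sitesPerDir j)))) μ₂ + (k : ZMod (P.sitesPerDir j))), μ₀⟩) ≤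
      (∑ t ∈ Finset.range k, dist1 (GaugeField.plaqHol U
        ⟨Function.update (Function.update p₁ μ₁ (p₁ μ₁ + (i : ZMod (P.sitesPerDir j)))) μ₂
          ((Function.update p₁ μ₁ (p₁ μ₁ + (i : ZMod (P.sitesPerDir j)))) μ₂ + (t : ZMod (P.sitesPerDir j))), μ₀, μ₂, h02⟩)) +
      ∑ t ∈ Finset.range i, dist1 (GaugeField.plaqHol U
        ⟨Function.update p₁ μ₁ (p₁ μ₁ + (t : ZMod (P.sitesPerDir j))), μ₀, μ₁, h01⟩) := by
  have hne20 : μ₂ ≠ μ₀ := (ne_of_lt h02).symm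
  set p₂ : Site P j := Function.update p₁ μ₁ (p₁ μ₁ + (i : ZMod (P.sitesPerDir j))) with hp₂
  have htgt : Site.shift (Function.update p₂ μ₂ (p₂ μ₂ + (k : ZMod (P.sitesPerDir j))) : Site P j) μ₀ =
      Function.update (p₂.shift μ₀) μ₂ ((p₂.shift μ₀) μ₂ + (k : ZMod (P.sitesPerDir j))) := by
    rw [shift_update_of_ne _ hne20, shift_eq_update p₂ μ₀, Function.update_of_ne hne20]
  -- the two ladder loops
  set W₂ : G := H p₂ μ₂ k * U ⟨Function.update p₂ μ₂ (p₂ μ₂ + (k : ZMod (P.sitesPerDir j))), μ₀⟩ *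
      (H (p₂.shift μ₀) μ₂ k)⁻¹ * (U ⟨p₂, μ₀⟩)⁻¹ with hW₂
  set W₁ : G := H p₁ μ₁ i * U ⟨Function.update p₁ μ₁ (p₁ μ₁ + (i : ZMod (P.sitesPerDir j))), μ₀⟩ *
      (H (p₁.shift μ₀) μ₁ i)⁻¹ * (U ⟨p₁, μ₀⟩)⁻¹ with hW₁
  have h₂ := dist1_ladderLoop_le U H hH0 hHs p₂ h02 k
  have h₁ := dist1_ladderLoop_le U H hH0 hHs p₁ h01 i
  have hbond : GaugeField.gaugeAct g U ⟨Function.update p₂ μ₂ (p₂ μ₂ + (k : ZMod (P.sitesPerDir j))), μ₀⟩ =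
      A₀ * ((H p₁ μ₁ i * W₂ * (H p₁ μ₁ i)⁻¹) * W₁) * A₀⁻¹ := by
    unfold GaugeField.gaugeAct
    simp only [PBond.tgt]
    rw [htgt, hgk, hgk']
    simp only [hW₂, hW₁, hp₂, mul_inv_rev]
    group
  rw [hbond, GaugeGroup.dist1_conj]
  calc dist1 ((H p₁ μ₁ i * W₂ * (H p₁ μ₁ i)⁻¹) * W₁)
      ≤ dist1 (H p₁ μ₁ i * W₂ * (H p₁ μ₁ i)⁻¹) + dist1 W₁ := GaugeGroup.dist1_mul_le _ _
    _ = dist1 W₂ + dist1 W₁ := by rw [GaugeGroup.dist1_conj]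
    _ ≤ _ := add_le_add h₂ h₁

end Comb

end Summit.QuantumFields.YangMills.Theorems.LocalInsertion.CombGauge
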